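import Summits.BirchSwinnertonDyer.BirchSwinnertonDyer.Theses.QuadraticBranchSignedControl
import Summits.BirchSwinnertonDyer.Rank1Residual.Additive.QuadraticBranchPlusKatoDivisibility
import Summits.BirchSwinnertonDyer.Rank1Residual.Additive.QuadraticBranchKatoBridge
import Summits.BirchSwinnertonDyer.Rank1Residual.Additive.LocIrrOddPrimes
import HarnessLib

/-!
# Route `QuadraticBranchSignedControl` (rung K8, cell `bsd-potss`), crux `PlusLowerInclusionSurjBranch`
# (item stmt-BirchSwinnertonDyer-19242, the Eisenstein half of (C1_η)): the FOUQUET–WAN SUB-LOCUS of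
# Gss2 — where the open inclusion is CLAIMED, modulo the two hypothesis SHAPES already in the tree

WHAT. On a Gss2 pair `(W, p)` (`W/ℚ` additive at `p ≥ 5`, potentially good supersingular with
`e = 2`: `Addv W p ∧ SubGss W p`) with twist partner `V` (`C • W^{(p*)} = V`, good at `p`, `a_p(V) = 0`):
IF `W` has a prime `q ≠ p` of NON-SPLIT multiplicative reduction at which `W[p]` is ramified
(`FWNonsplitRam W p`, census-decidable) and the `p`-adic image of `W` contains `SL₂(ℤ_p)`
(`Kato2004.ImageContainsSL2 W p`), THEN the Eisenstein inclusion (E⁺)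
`QuadraticBranchPlusLowerInclusionAt V p` — and indeed the whole (C1_η)
`QuadraticBranchPlusMainConjectureAt V p` — follow from the two HYPOTHESIS SHAPES over the cell's
abstract interface `KMC` (Kato's Main Conjecture 12.10 for `f_W` on the `Δ`-trivial component,
definition request D-O6-2):
* `FouquetWanClaimShape KMC` (`Additive/FouquetWanLocus.lean`): Fouquet–Wan arXiv:2107.13726 Thm. 5.1 /
  1.7 for `f = f_W` at an odd `p` on `ClassX4 ∧ LocIrr ∧ FWNonsplitRam` ⟹ `KMC W p` — an UNREFEREED
  CLAIM (PRE; its non-ordinary Eisenstein side rests on Wan's withdrawn 2015 preprint), consumed ONLY as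
  an explicit hypothesis; the level `Np^r` of Thm. 5.1 allows the additive prime (`p² ∣ N_W`);
* `QuadraticBranchKatoBridge KMC` (`Additive/QuadraticBranchKatoBridge.lean`, p402082): the currency
  bridge `KMC W p ↔ (C1_η)(V)` under `SL₂`-image (Kobayashi Thm. 7.4 at `η` + the zeta-element twist
  comparison; nothing asserted).
On Gss2 the local hypothesis `LocIrr W p` of the claim is AUTOMATIC (`locIrr_of_subGss`: the twist `V`
is good supersingular, Serre's Prop. 12), so `ClassX4 W p` too (`classX4_of_addv_of_locIrr`); the
sub-locus is cut out by `FWNonsplitRam` and the image condition alone.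

So this file records, in the kernel, WHERE inside crux 19242 the literature has a (claimed) two-layer
parent — the Gss2 analogue of the `stub_lower_fwLocus` split of the sibling routes K8-t′ / K9 — and
its complement (no non-split Steinberg prime with `W[p]` ramified, or image not containing `SL₂(ℤ_p)`)
where NOTHING is in print. Composition only (`plusMC_of_kmc_of_bridge` ∘ `hFW`, then
`quadraticBranchPlusLowerInclusionAt_of_plusMainConjectureAt`); the mathematics is in the two shapes.

HONEST FRAMING (cell `bsd-potss`, run/shared/lean/pub/bsd-potss/; FULL-BSD rank ≤ 1 programme): TOOL
THEOREMS ONLY — no definition, no named fact, no `sorry`, axioms standard. CONDITIONAL on two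
hypothesis SHAPES, one of which transcribes an UNREFEREED preprint; nothing is asserted about any
curve; the crux / the item / the route are NOT closed; nothing is booked; `BSD(W, p)` is claimed for
no pair; this is not "finishing BSD". Seat `bsd-potss-k8q-c2` (prover), g0;
`--supports stmt-BirchSwinnertonDyer-19242` (helper).

References: [FouquetWan2021] Thm. 5.1 / Thm. 1.7 (p. 5, p. 53; claim); [Kato2004Asterisque] Conj. 12.10
(p. 224); [Kobayashi2003] Thm. 7.4 (p. 13), §4 (p. 8); [Serre1972] §1.11 Prop. 12 (LocIrr at a
supersingular prime).
-/

set_option autoImplicit false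
set_option linter.dupNamespace false

noncomputable section

open scoped Classical

open WeierstrassCurve
open Literature.NumberTheory.EllipticCurves
open Literature.NumberTheory.EllipticCurves.Rank1Residual
open Summit.BirchSwinnertonDyer.Rank1Residual.Additive
open Summit.BirchSwinnertonDyer.BirchSwinnertonDyer.Theses.QuadraticBranchSignedControl

namespace Summit.BirchSwinnertonDyer.BirchSwinnertonDyer.Theorems

variable {KMC : ∀ (W : WeierstrassCurve ℚ) [W.IsElliptic] [W.IsGloballyMinimal] (p : ℕ), Prop}

/-- **(C1_η) on the Fouquet–Wan sub-locus of Gss2, from the two shapes.** For a Gss2 pair `(W, p)`,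
`p ≥ 5` (`Addv W p`, `SubGss W p`), its twist partner `V` (`C • W^{(p*)} = V`, good at `p`,
`a_p(V) = 0`), a non-split multiplicative prime `q ≠ p` with `W[p]` ramified (`FWNonsplitRam W p`) and
`SL₂(ℤ_p) ⊆ im ρ_{W,p^∞}` (`ImageContainsSL2 W p`): `FouquetWanClaimShape KMC` (the CLAIM, hypothesis)
and `QuadraticBranchKatoBridge KMC` (the bridge, hypothesis) give `QuadraticBranchPlusMainConjectureAt V p`
— `LocIrr W p` being automatic on Gss2 (`locIrr_of_subGss`). Composition; CONDITIONAL; closes nothing.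
[cite: FouquetWan2021, Thm. 5.1 and Thm. 1.7 (claim; hypothesis only)]
[cite: Kobayashi2003, Thm. 7.4 (p. 13)] [cite: Serre1972, §1.11 Prop. 12] -/
theorem quadraticBranchPlusMainConjectureAt_of_fouquetWanClaimShape_of_bridge
    (hFW : FouquetWanClaimShape KMC) (hB : QuadraticBranchKatoBridge KMC)
    (W : WeierstrassCurve ℚ) [W.IsElliptic] [W.IsGloballyMinimal]
    (V : WeierstrassCurve ℚ) [V.IsElliptic] [V.IsGloballyMinimal] (C : VariableChange ℚ)
    (p : ℕ) [Fact p.Prime] (hp5 : 5 ≤ p) (hWV : C • W.quadraticTwist ((-1) ^ (p / 2) * p) = V)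
    (hgood : V.HasGoodReductionAtPrime p) (hap : V.frobeniusTrace p = 0)
    (hadd : Addv W p) (hG : SubGss W p) (hR : FWNonsplitRam W p)
    (hK : Kato2004.ImageContainsSL2 W p) : QuadraticBranchPlusMainConjectureAt V p := by
  have hp2 : p ≠ 2 := by omega
  have hL : LocIrr W p := locIrr_of_subGss W p hp5 hadd hG
  exact plusMC_of_kmc_of_bridge hB W V C p hp2 hWV hgood hap hK
    (hFW W p (classX4_of_addv_of_locIrr W p hp2 hadd hL) hL hR)

/-- **The Eisenstein inclusion (E⁺) — the content of crux `PlusLowerInclusionSurjBranch` (item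
19242) — on the Fouquet–Wan sub-locus of Gss2, from the two shapes**: same binders; (C1_η) from the
shapes (previous theorem) gives (E⁺) by `quadraticBranchPlusLowerInclusionAt_of_plusMainConjectureAt`
(p418001). So inside item 19242 the rows {`FWNonsplitRam W p` ∧ `ImageContainsSL2 W p`} have the
CLAIMED two-layer parent Fouquet–Wan ⟹ KMC ⟹ (C1_η) ⟹ (E⁺); the complement has nothing in print.
Composition; CONDITIONAL on an unrefereed claim-shape and the bridge-shape; closes nothing.
[cite: FouquetWan2021, Thm. 5.1 and Thm. 1.7 (claim; hypothesis only)]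
[cite: Kato2004Asterisque, Conj. 12.10 (p. 224)] [cite: Kobayashi2003, §4 (p. 8) and Thm. 7.4 (p. 13)] -/
theorem quadraticBranchPlusLowerInclusionAt_of_fouquetWanClaimShape_of_bridge
    (hFW : FouquetWanClaimShape KMC) (hB : QuadraticBranchKatoBridge KMC)
    (W : WeierstrassCurve ℚ) [W.IsElliptic] [W.IsGloballyMinimal]
    (V : WeierstrassCurve ℚ) [V.IsElliptic] [V.IsGloballyMinimal] (C : VariableChange ℚ)
    (p : ℕ) [Fact p.Prime] (hp5 : 5 ≤ p) (hWV : C • W.quadraticTwist ((-1) ^ (p / 2) * p) = V)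
    (hgood : V.HasGoodReductionAtPrime p) (hap : V.frobeniusTrace p = 0)
    (hadd : Addv W p) (hG : SubGss W p) (hR : FWNonsplitRam W p)
    (hK : Kato2004.ImageContainsSL2 W p) : QuadraticBranchPlusLowerInclusionAt V p :=
  quadraticBranchPlusLowerInclusionAt_of_plusMainConjectureAt
    (quadraticBranchPlusMainConjectureAt_of_fouquetWanClaimShape_of_bridge hFW hB W V C p hp5 hWV
      hgood hap hadd hG hR hK)

/-- **Route-level form.** Granted the two shapes, the crux `PlusLowerInclusionSurjBranch` RESTRICTED to
the twists `V` admitting a Gss2 partner `W` on the Fouquet–Wan sub-locus (`FWNonsplitRam`, `SL₂`-image)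
holds — displayed as the implication with that extra datum; the tower-surjectivity hypothesis of the
crux is not even needed there. The complement of the sub-locus inside 19242 is untouched.
CONDITIONAL; closes nothing. [cite: FouquetWan2021, Thm. 5.1 (claim; hypothesis only)] -/
theorem plusLowerInclusion_on_fouquetWanLocus_of_shapes
    (hFW : FouquetWanClaimShape KMC) (hB : QuadraticBranchKatoBridge KMC) :
    ∀ (V : WeierstrassCurve ℚ) [V.IsElliptic] [V.IsGloballyMinimal] (p : ℕ) [Fact p.Prime],
      5 ≤ p → V.HasGoodReductionAtPrime p → V.frobeniusTrace p = 0 →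
      (∃ (W : WeierstrassCurve ℚ) (_ : W.IsElliptic) (_ : W.IsGloballyMinimal) (C : VariableChange ℚ),
        C • W.quadraticTwist ((-1) ^ (p / 2) * p) = V ∧ Addv W p ∧ SubGss W p ∧
          FWNonsplitRam W p ∧ Kato2004.ImageContainsSL2 W p) →
      QuadraticBranchPlusLowerInclusionAt V p := by
  intro V _ _ p _ hp5 hgood hap hW
  obtain ⟨W, _, _, C, hWV, hadd, hG, hR, hK⟩ := hW
  exact quadraticBranchPlusLowerInclusionAt_of_fouquetWanClaimShape_of_bridge hFW hB W V C p hp5 hWV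
    hgood hap hadd hG hR hK

end Summit.BirchSwinnertonDyer.BirchSwinnertonDyer.Theorems

end
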